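import Summits.BirchSwinnertonDyer.BirchSwinnertonDyer.Theorems.GenusKolyvaginAtTwoGenusPrimitiveSupplyAtTwoHeegnerTwinParity
import Summits.BirchSwinnertonDyer.BirchSwinnertonDyer.Theorems.ByReductionTypeAtTwoRankOneAtTwoBigImageOddLocalOneDoorBottomTranspositionCount
import Summits.BirchSwinnertonDyer.BirchSwinnertonDyer.Theorems.GenusKolyvaginAtTwoEquivariantKolyvaginExactAtTwoPairBookkeeping
import HarnessLib

/-!
# Route `GenusKolyvaginAtTwo`, LINE 13, crux U `ShaCardDvdPowAtTwoR` (stmt-BirchSwinnertonDyer-28029):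
# the DEFECT PRIMES of the `ℚ`-pair frame — on `Δ(E) < 0` the Heegner field ALWAYS has a transposition prime,
# so the "DEF-free" sub-habitat `∀ v ∣ d_K, #E(ℚ_v)[2] = 1` of LINE 6 is EMPTY

Seat `bsd-line-gk2-p3` g14 (cell `bsd-f1-sign2`), `--supports stmt-BirchSwinnertonDyer-28029` (helper; closes nothing).
THEOREMS ONLY (no definition, no named fact, no `sorry`); BSD is not proved by any of this.

The LINE-6 `ℚ`-pair instance of Kolyvagin's descent at `2` (`GenusExact.VisiblePairAtTwo.Input`, files
`…VisiblePairAtTwoInputReductionsHeegner` p651084, `…ClaimsOfK` p651711, `…ClaimsOfHeegner` p651994,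
`…H2Vacuity` p654425) displays the hypothesis

  `hDEF : ∀ v, (d_K : 𝓞 ℚ) ∈ v → Nat.card (ker (2 • · : E(ℚ_v) → E(ℚ_v))) = 1`   ("DEF-free"),

under which McCallum's Lemma 4.3 over `ℚ` at the primes of `d_K` is free (`H¹(ℚ_v, E[2^M]) = 0`) and under which
`…H2Vacuity.input_isEmpty_of_DEF_free` shows the record `Input` uninhabited.  This file records that `hDEF` itself is
UNSATISFIABLE on the habitat of the crux (`Δ(E) < 0`, `K` imaginary quadratic with `d_K` odd, Heegner hypothesis for
`N_E`): by the reciprocity law of the twin lineage (`GenusKolyTwin.exists_prime_dvd_discr_jacobiSym_eq_neg_one_of_Δ_neg`,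
LEAD `bsd-line-gk2-p1`; the parity «DEF(E,K) is odd» of `…KolyvaginExactAtTwoDefectParity`, seat `bsd-line-gk2-p2` g4)
some prime `q ∣ d_K` is a TRANSPOSITION prime — `q` odd, `q ∤ N_E Δ_min`, `(Δ_min/q) = −1`, i.e. `Frob_q` swaps two of
the three non-zero `2`-torsion points — and at such a prime `#E(ℚ_q)[2] = 2` (route ByReductionTypeAtTwo's local count
`RankOneAtTwoOneDoor.natCard_ker_nsmul_adicCompletion_two_eq_two_of_jacobiSym`, seat `bsd-line-fkl-p2` g10).

* §1 `exists_place_dvd_discr_natCard_ker_two_eq_two` — **on `Δ < 0` some place `v ∣ d_K`, `v ∤ 2 N_E`, has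
  `#E(ℚ_v)[2] = 2`** (in the `nsmulAddMonoidHom 2` currency of `hDEF`).
* §2 `not_DEF_free_of_Δ_neg` — **`hDEF` is false on the habitat**; hence every theorem of the LINE-6 chain carrying
  `hDEF` has contradictory hypotheses on `Δ < 0`, and on the true habitat the displayed Lemma-4.3/`ℚ` hypotheses of
  `Input` (`loc_c₁_fin`, `loc_c₂_fin` at `v ∣ d_K`) sit at places where `H¹(ℚ_v, E[2^M]) ≠ 0`
  (`natCard_ker_two_ne_one`, the local group that carries Kramer's norm index `E(ℚ_v)/N E(K_w) ≅ ℤ/2`,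
  [Kramer1981] Prop. 3, [MazurRubin2010] Lemma 2.2 (i)).

References: [GrossLMS1991] §3 (3.3), §4; [McCallumLMS1991] §4 Lemma 4.3; [Kramer1981] Prop. 3; [MazurRubin2010]
Lemma 2.2 (i); [IrelandRosen1990] Prop. 5.2.2; [SilvermanAEC2009] VII.4.1, VIII.8.
-/

set_option autoImplicit false
set_option linter.dupNamespace false -- tree convention: `Summit.BirchSwinnertonDyer.BirchSwinnertonDyer.Theorems` (summit = sub-problem)

noncomputable section

open scoped Classical

namespace Summit.BirchSwinnertonDyer.BirchSwinnertonDyer.Theorems.GenusExact.VisiblePairAtTwo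

open WeierstrassCurve NumberField IsDedekindDomain Field Rat.HeightOneSpectrum
open Literature.NumberTheory.EllipticCurves
open Summit.BirchSwinnertonDyer.BirchSwinnertonDyer.Theorems.GenusKolyTwin
open Summit.BirchSwinnertonDyer.BirchSwinnertonDyer.Theorems.RankOneAtTwoOneDoor

variable (W : WeierstrassCurve ℚ) [W.IsElliptic] [W.IsGloballyMinimal] {K : Type} [Field K] [NumberField K]

/-! ## §1 A transposition prime of `d_K` with `#E(ℚ_v)[2] = 2` -/

omit [W.IsElliptic] in
/-- For a globally minimal `W/ℚ` the numerator of `Δ` is the minimal discriminant. [cite: SilvermanAEC2009, VIII.8] -/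
theorem num_Δ_eq_minimalDiscriminantInt : W.Δ.num = minimalDiscriminantInt W := by
  rw [← cast_minimalDiscriminantInt W, Rat.num_intCast]

/-- **On `Δ(E) < 0` the Heegner field has a transposition prime where `#E(ℚ_v)[2] = 2`.** For `W/ℚ` globally minimal
with `W.Δ < 0` and `K` imaginary quadratic with odd discriminant satisfying the Heegner hypothesis for the conductor of
`W`, there are an odd prime `q ∣ d_K`, `q ∤ N_W`, with `(Δ_min/q) = −1`, and its place `v` (`q ∈ v`, `2 ∉ v`,
`d_K ∈ v`) with `Nat.card E(ℚ_v)[2] = 2`. [cite: IrelandRosen1990, Prop. 5.2.2] [cite: Kramer1981, Prop. 3]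
[cite: MazurRubin2010, Lemma 2.2 (i)] -/
theorem exists_place_dvd_discr_natCard_ker_two_eq_two (hK : IsImaginaryQuadratic K) (hodd : Odd (discr K))
    (hH : SatisfiesHeegnerHypothesis (W.conductorNorm ℤ) K) (hΔ : W.Δ < 0) :
    ∃ (q : ℕ) (v : HeightOneSpectrum (𝓞 ℚ)), q.Prime ∧ q ≠ 2 ∧ (q : ℤ) ∣ discr K ∧ ¬ q ∣ W.conductorNorm ℤ ∧
      jacobiSym (minimalDiscriminantInt W) q = -1 ∧ (q : 𝓞 ℚ) ∈ v.asIdeal ∧ (2 : 𝓞 ℚ) ∉ v.asIdeal ∧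
      ((discr K : ℤ) : 𝓞 ℚ) ∈ v.asIdeal ∧
      Nat.card (nsmulAddMonoidHom 2 : (W.baseChange (v.adicCompletion ℚ)).toAffine.Point →+ _).ker = 2 := by
  obtain ⟨q, hq, hq2, hqd, hqN, hqΔ, hjac⟩ := exists_prime_dvd_discr_jacobiSym_eq_neg_one_of_Δ_neg W hK hodd hH hΔ
  haveI : Fact q.Prime := ⟨hq⟩
  set v : HeightOneSpectrum (𝓞 ℚ) := primesEquiv.symm ⟨q, hq⟩ with hv
  have hqv : (q : 𝓞 ℚ) ∈ v.asIdeal := natCast_mem_primesEquiv_symm hq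
  have hgood : W.HasGoodReductionAtPrime q := by
    by_contra h
    exact hqN ((W.dvd_conductorNorm_iff_not_hasGoodReductionAtPrime q).mpr h)
  have hqΔ' : ¬ (q : ℤ) ∣ W.Δ.num := by rwa [num_Δ_eq_minimalDiscriminantInt W]
  have hjac' : jacobiSym W.Δ.num q = -1 := by rwa [num_Δ_eq_minimalDiscriminantInt W]
  refine ⟨q, v, hq, hq2, hqd, hqN, hjac, hqv, ?_, ?_,
    natCard_ker_nsmul_adicCompletion_two_eq_two_of_jacobiSym W hq2 hgood hqΔ' hjac' hqv⟩
  · intro h2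
    have h2' : ((2 : ℕ) : 𝓞 ℚ) ∈ v.asIdeal := by exact_mod_cast h2
    exact hq2 ((natGenerator_eq_of_natCast_prime_mem hq hqv).symm.trans
      (natGenerator_eq_of_natCast_prime_mem Nat.prime_two h2'))
  · obtain ⟨k, hk⟩ := hqd
    have hcast : ((discr K : ℤ) : 𝓞 ℚ) = (q : 𝓞 ℚ) * ((k : ℤ) : 𝓞 ℚ) := by rw [hk]; push_cast; ring
    rw [hcast]
    exact Ideal.mul_mem_right _ _ hqv

/-! ## §2 The DEF-free sub-habitat is empty -/

/-- **`hDEF` is unsatisfiable on `Δ < 0`**: it is NOT the case that `#E(ℚ_v)[2] = 1` at every place `v ∣ d_K`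
(habitat: `W/ℚ` globally minimal with `Δ < 0`, `K` imaginary quadratic, `d_K` odd, Heegner hypothesis).  Consequently the
theorems `…InputReductionsHeegner.loc_c₁_fin_of_K_of_heegner` / `…ClaimsOfK.exists_input_of_K` /
`…ClaimsOfHeegner.*` / `…H2Vacuity.input_isEmpty_of_DEF_free`, which all carry this hypothesis, have contradictory
hypotheses on the habitat of the crux. [cite: IrelandRosen1990, Prop. 5.2.2] [cite: Kramer1981, Prop. 3] -/
theorem not_DEF_free_of_Δ_neg (hK : IsImaginaryQuadratic K) (hodd : Odd (discr K))
    (hH : SatisfiesHeegnerHypothesis (W.conductorNorm ℤ) K) (hΔ : W.Δ < 0) :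
    ¬ ∀ v : HeightOneSpectrum (𝓞 ℚ), ((discr K : ℤ) : 𝓞 ℚ) ∈ v.asIdeal →
      Nat.card (nsmulAddMonoidHom 2 : (W.baseChange (v.adicCompletion ℚ)).toAffine.Point →+ _).ker = 1 := by
  intro h
  obtain ⟨q, v, -, -, -, -, -, -, -, hdv, hcard⟩ := exists_place_dvd_discr_natCard_ker_two_eq_two W hK hodd hH hΔ
  have h1 := h v hdv
  omega

/-- **At a transposition place the local group of the `ℚ`-descent is non-trivial**: there is a place `v ∣ d_K`,
`v ∤ 2`, with `Nat.card E(ℚ_v)[2] ≠ 1` — the place where Kramer's local norm index `E(ℚ_v)/N E(K_w)` is `ℤ/2` and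
McCallum's Lemma 4.3 over `ℚ` for a class descended from `K` is a genuine condition. [cite: Kramer1981, Prop. 3]
[cite: MazurRubin2010, Lemma 2.2 (i)] [cite: McCallumLMS1991, §4 Lemma 4.3] -/
theorem exists_place_dvd_discr_natCard_ker_two_ne_one (hK : IsImaginaryQuadratic K) (hodd : Odd (discr K))
    (hH : SatisfiesHeegnerHypothesis (W.conductorNorm ℤ) K) (hΔ : W.Δ < 0) :
    ∃ v : HeightOneSpectrum (𝓞 ℚ), ((discr K : ℤ) : 𝓞 ℚ) ∈ v.asIdeal ∧ (2 : 𝓞 ℚ) ∉ v.asIdeal ∧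
      Nat.card (nsmulAddMonoidHom 2 : (W.baseChange (v.adicCompletion ℚ)).toAffine.Point →+ _).ker ≠ 1 := by
  obtain ⟨q, v, -, -, -, -, -, -, h2v, hdv, hcard⟩ := exists_place_dvd_discr_natCard_ker_two_eq_two W hK hodd hH hΔ
  exact ⟨v, hdv, h2v, by omega⟩

end Summit.BirchSwinnertonDyer.BirchSwinnertonDyer.Theorems.GenusExact.VisiblePairAtTwo

end
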